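import Summits.RiemannHypothesis.RiemannHypothesis.Theorems.SemilocalNegCertWide
import HarnessLib

/-!
# Semi-local thresholds, negative side (IIIe): the FAST atom side — synthetic division instead of the Taylor shift

Cell `rh-explicit` (HOME `run/shared/lean/pub/rh-explicit/`), seat cc-s2-4 gen9 (A4 lane, the Lean side).  Honest framing:
bookkeeping about the tree's rational certificate checkers; nothing here bears on RH.  No data is trusted.

MEASURED (gen9, `HOME/cc-s2-4/CC4-LEAN.md` §14.8): after the moment tables (`SemilocalGridMoments.lean`) the remaining hot spot
of a wall instance is the ATOM side `atomLhsQ inc atoms = Σ whi · evalUpperQ inc lo (hi − lo)` (`SemilocalNegTerms.lean`):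
`evalUpperQ` Taylor-shifts the increment list (degree `2d+1`) at every atom — `O(d²)` products of rationals with `≈ 20·(2d+1)`-digit
denominators — so a degree-21 wall with 28 atoms spends `≈ 300 s` of kernel there alone.  Here the SAME kind of bound is obtained by
two synthetic divisions (`O(d)` per atom):

* `LQ.synDiv l c` with `ev l x = ev l c + (x − c)·ev (synDiv l c) x` (`ev_eq_add_mul_synDiv`);
* `LQ.evalUpperFastQ l c δ h = l(c) + δ·max(Q(c), 0) + δ²·absBound R h`, `Q = synDiv l c`, `R = synDiv Q c`, an upper bound of `l`
  on `[c, c + δ] ∩ [−h, h]` (`ev_le_evalUpperFastQ`);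
* `atomLhsFastQ inc h atoms = Σ whi · evalUpperFastQ inc lo (hi − lo) h` and `atoms_sum_le_atomLhsFastQ`;
* the two soundness theorems of `WeilNegCertP` RESTATED with the fast atom side in place of `checkAtoms`
  (`weilSemilocalThreshold_le_of_checkP_fast`, `…_checkW_fast` + `_sharp` forms): hypotheses `incrementL c.p c.b = incL`
  (the instance's increment literal, proved once by `decide`) and `atomLhsFastQ incL (2·c.b) c.atoms ≤ c.atomB` (a `decide`
  of `O(d)` products per atom); the rest of the proof is the tree's, verbatim.

Folklore throughout (Horner 1819 / Ruffini synthetic division; Taylor's theorem with the Lagrange form replaced by an absolute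
coefficient bound, as in R. E. Moore, *Interval Analysis* (1966) Ch. 3).
-/

set_option autoImplicit false
set_option linter.dupNamespace false  -- the mandated namespace repeats `RiemannHypothesis`

noncomputable section

open Complex Filter Set MeasureTheory Topology
open scoped Real

namespace Summit.RiemannHypothesis.RiemannHypothesis.Theorems.SemilocalPolyWitness

open MeasureTheory Set Finset Real
open Literature.NumberTheory.LFunctions
open Summit.RiemannHypothesis.RiemannHypothesis.Theorems.MotivicDoor
open Summit.RiemannHypothesis.RiemannHypothesis.Theorems.MotivicDoor.SemilocalThreshold
open Summit.RiemannHypothesis.RiemannHypothesis.Theorems.MotivicDoor.SemilocalMarkov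
open LQ

namespace LQ

/-! ## Synthetic division and the fast upper bound -/

/-- Synthetic division at `c`: the quotient `Q` with `l(x) = l(c) + (x − c)·Q(x)` (`Q(x) = as(c) + x·Q_as(x)` for `l = a :: as`). -/
def synDiv : List ℚ → ℚ → List ℚ
  | [], _ => []
  | _ :: as, c => evQ as c :: synDiv as c

/-- **Synthetic division identity**: `l(x) = l(c) + (x − c)·(synDiv l c)(x)`. -/
theorem ev_eq_add_mul_synDiv : ∀ (l : List ℚ) (c : ℚ) (x : ℝ),
    ev l x = ev l c + (x - c) * ev (synDiv l c) x
  | [], c, x => by simp [synDiv]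
  | a :: as, c, x => by
      rw [synDiv, ev_cons, ev_cons, ev_cons, ev_eq_add_mul_synDiv as c x, ev_ratCast as c]
      ring

/-- The fast upper bound of `l` on `[c, c + δ] ∩ [−h, h]`:
`l(c) + δ·max(Q(c), 0) + δ²·absBound R h` with `Q = synDiv l c`, `R = synDiv Q c`. -/
def evalUpperFastQ (l : List ℚ) (c δ h : ℚ) : ℚ :=
  evQ l c + δ * max (evQ (synDiv l c) c) 0 + δ ^ 2 * absBound (synDiv (synDiv l c) c) h

/-- **Soundness of the fast bound**: `ev l x ≤ evalUpperFastQ l c δ h` for `c ≤ x ≤ c + δ`, `|x| ≤ h`. -/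
theorem ev_le_evalUpperFastQ (l : List ℚ) {c δ h : ℚ} {x : ℝ} (h0 : (c : ℝ) ≤ x) (h1 : x ≤ (c : ℝ) + δ)
    (hx : |x| ≤ h) : ev l x ≤ (evalUpperFastQ l c δ h : ℝ) := by
  have e1 := ev_eq_add_mul_synDiv l c x
  have e2 := ev_eq_add_mul_synDiv (synDiv l c) c x
  have hy0 : 0 ≤ x - c := by linarith
  have hyδ : x - c ≤ δ := by linarith
  have hδ : (0 : ℝ) ≤ δ := hy0.trans hyδ
  have hR' : ev (synDiv (synDiv l c) c) x ≤ (absBound (synDiv (synDiv l c) c) h : ℝ) :=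
    (le_abs_self _).trans (abs_ev_le_absBound _ hx)
  have hRnonneg : (0 : ℝ) ≤ absBound (synDiv (synDiv l c) c) h :=
    (abs_nonneg _).trans (abs_ev_le_absBound _ hx)
  have hlin : (x - c) * ev (synDiv l c) c ≤ δ * max (((evQ (synDiv l c) c : ℚ)) : ℝ) 0 := by
    rw [ev_ratCast]
    by_cases hq : (0 : ℝ) ≤ ((evQ (synDiv l c) c : ℚ) : ℝ)
    · rw [max_eq_left hq]; exact mul_le_mul_of_nonneg_right hyδ hq
    · rw [max_eq_right (le_of_not_ge hq)]; nlinarith [lt_of_not_ge hq]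
  have hquad : (x - c) * ((x - c) * ev (synDiv (synDiv l c) c) x) ≤
      (δ : ℝ) ^ 2 * absBound (synDiv (synDiv l c) c) h := by
    have h2 : (x - c) * (x - c) ≤ (δ : ℝ) ^ 2 := by rw [sq]; exact mul_le_mul hyδ hyδ hy0 hδ
    calc (x - c) * ((x - c) * ev (synDiv (synDiv l c) c) x)
        = ((x - c) * (x - c)) * ev (synDiv (synDiv l c) c) x := by ring
      _ ≤ ((x - c) * (x - c)) * absBound (synDiv (synDiv l c) c) h :=
          mul_le_mul_of_nonneg_left hR' (mul_nonneg hy0 hy0)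
      _ ≤ (δ : ℝ) ^ 2 * absBound (synDiv (synDiv l c) c) h := mul_le_mul_of_nonneg_right h2 hRnonneg
  rw [evalUpperFastQ]
  push_cast
  rw [e1, e2, ← ev_ratCast l c]
  have hx' : (x - ↑c) * (ev (synDiv l c) ↑c + (x - ↑c) * ev (synDiv (synDiv l c) c) x) =
      (x - c) * ev (synDiv l c) c + (x - c) * ((x - c) * ev (synDiv (synDiv l c) c) x) := by ring
  rw [hx']
  linarith

end LQ

/-! ## The fast atom side -/

/-- The rational atom side with the fast evaluator: `Σ_atoms whi · evalUpperFastQ inc lo (hi − lo) h`. -/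
def atomLhsFastQ (inc : List ℚ) (h : ℚ) : List (ℕ × AtomQ) → ℚ
  | [] => 0
  | na :: rest => na.2.whi * evalUpperFastQ inc na.2.lo (na.2.hi - na.2.lo) h + atomLhsFastQ inc h rest

/-- The atom energy of a function whose increments on the atoms are bounded by the fast evaluator is at most `atomLhsFastQ`. -/
theorem atoms_sum_le_atomLhsFastQ {S : Finset ℕ} (inc : List ℚ) (h : ℚ) {D : ℝ → ℝ} :
    ∀ atoms : List (ℕ × AtomQ),
      (∀ na ∈ atoms, weilSemilocalCoeff S na.1 ≤ (na.2.whi : ℝ)) →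
      (∀ na ∈ atoms, 0 ≤ D (Real.log na.1) ∧
        D (Real.log na.1) ≤ (evalUpperFastQ inc na.2.lo (na.2.hi - na.2.lo) h : ℝ)) →
      (atoms.map fun na ↦ weilSemilocalCoeff S na.1 * D (Real.log na.1)).sum ≤ (atomLhsFastQ inc h atoms : ℝ)
  | [], _, _ => by simp [atomLhsFastQ]
  | na :: rest, hw, hD => by
      simp only [List.map_cons, List.sum_cons, atomLhsFastQ]
      push_cast
      have h1 : weilSemilocalCoeff S na.1 * D (Real.log na.1) ≤
          (na.2.whi : ℝ) * evalUpperFastQ inc na.2.lo (na.2.hi - na.2.lo) h :=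
        mul_le_mul (hw na (by simp)) (hD na (by simp)).2 (hD na (by simp)).1
          ((weilSemilocalCoeff_nonneg S na.1).trans (hw na (by simp)))
      have h2 := atoms_sum_le_atomLhsFastQ inc h rest (fun x hx ↦ hw x (by simp [hx])) (fun x hx ↦ hD x (by simp [hx]))
      linarith

/-! ## Soundness of `WeilNegCertP` with the fast atom side (formats P and W) -/

/-- **SOUNDNESS of `WeilNegCertP` with the FAST atom side** (`atomLhsFastQ` of the increment literal in place of `checkAtoms`). -/
theorem weilSemilocalThreshold_le_of_checkP_fast (c : WeilNegCertP) {S : Finset ℕ} {N : ℕ} {c0 : ℚ}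
    (henc : AtomsEnclose S N c.atoms c.logSuccLo) (hc0 : (c0 : ℝ) ≤ semilocalEmptyConstant)
    (hmain : c.checkMain c0 = true) {incL : List ℚ} (hinc : incrementL c.p c.b = incL)
    (hat : atomLhsFastQ incL (2 * c.b) c.atoms ≤ c.atomB)
    (hpieces : ∀ i, i < c.cuts.length → c.checkPiece i = true) :
    weilSemilocalThreshold S ≤ (c.b : ℝ) := by
  simp only [WeilNegCertP.checkMain, Bool.and_eq_true, decide_eq_true_eq] at hmain
  obtain ⟨⟨⟨⟨⟨⟨⟨⟨⟨⟨⟨⟨⟨hodd, hb0⟩, hb2⟩, hnA⟩, hnt⟩, hne⟩, hhead⟩, htail1⟩, hatoms⟩, hsucc⟩, hcuts⟩, hlast⟩,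
    hlen⟩, hfinal⟩ := hmain
  simp only [WeilNegCertP.checkPiece, decide_eq_true_eq] at hpieces
  rw [atomsOk_iff] at hatoms
  obtain ⟨hnodup, hsub, hcover, hencl, hlogSucc⟩ := henc
  set p := c.p
  set b := c.b
  have hb0' : (0 : ℝ) < b := by exact_mod_cast hb0
  have hbwin : (b : ℝ) < Real.log ((N : ℝ) + 1) / 2 := by
    have h1 : ((2 * b : ℚ) : ℝ) < c.logSuccLo := by exact_mod_cast hsucc
    push_cast at h1
    linarith
  set G := polyWitness p b with hG
  have hW := isMarkovWitness_polyWitness (p := p) (b := b) hodd hb0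
  set inc := incrementL p b
  set Nm : ℝ := (LQ.normSq p b : ℝ)
  have hN : ∫ x, ‖G x‖ ^ 2 = Nm := integral_norm_sq_polyWitness (p := p) hb0
  have hN0 : 0 ≤ Nm := by rw [← hN]; exact integral_nonneg fun x ↦ by positivity
  -- D on (0, 2b]
  have hDev : ∀ t ∈ Set.Ioc (0 : ℝ) ((2 * b : ℚ) : ℝ), weilIncrement G t = ev inc t := fun t ht ↦
    weilIncrement_polyWitness_eq_ev hodd hb0 ht.1.le (by push_cast at ht; exact ht.2)
  have hDq : ∀ t ∈ Set.Ioc (0 : ℝ) ((2 * b : ℚ) : ℝ), weilIncrement G t = t * ev c.q t := fun t ht ↦ by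
    rw [hDev t ht, ev_eq_headD_add_tail, hhead]
    push_cast
    rw [zero_add]
    rfl
  have hq : ∀ t ∈ Set.Ioc (0 : ℝ) ((2 * b : ℚ) : ℝ), 0 ≤ ev c.q t := fun t ht ↦ by
    have h1 := weilIncrement_nonneg G t
    rw [hDq t ht] at h1
    exact (mul_nonneg_iff_of_pos_left ht.1).1 h1
  -- atoms
  have hAt : semilocalAtomEnergy S N G ≤ (c.atomB : ℝ) := by
    unfold semilocalAtomEnergy
    rw [sum_range_eq_atoms_sum (h := fun n ↦ weilSemilocalCoeff S n * weilIncrement G (Real.log n)) hnodup hsub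
      (fun n hn hnot ↦ by rw [hcover n hn hnot, zero_mul])]
    have hincL : inc = incL := hinc
    refine (atoms_sum_le_atomLhsFastQ incL (2 * b) c.atoms (fun na hna ↦ (hencl na hna).2.2.2) (fun na hna ↦ ?_)).trans
      (by exact_mod_cast hat)
    obtain ⟨hlo0, _, hhiT⟩ := hatoms na hna
    obtain ⟨hlo, hhi, _, _⟩ := hencl na hna
    have hmem : Real.log na.1 ∈ Set.Ioc (0 : ℝ) ((2 * b : ℚ) : ℝ) :=
      ⟨lt_of_lt_of_le (by exact_mod_cast hlo0) hlo, hhi.trans (by exact_mod_cast hhiT)⟩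
    refine ⟨weilIncrement_nonneg G _, ?_⟩
    rw [hDev _ hmem, hincL]
    have habs : |Real.log na.1| ≤ ((2 * b : ℚ) : ℝ) := by
      rw [abs_of_pos hmem.1]; exact hmem.2
    exact ev_le_evalUpperFastQ incL hlo (by push_cast; linarith) habs
  -- bulk over the pieces
  have hlastR : ((lastCut 0 c.cuts : ℚ) : ℝ) = ((2 * b : ℚ) : ℝ) := by rw [hlast]
  have h4 : ((lastCut 0 c.cuts : ℚ) : ℝ) ≤ 4 := by
    rw [hlastR]; push_cast
    have : (b : ℝ) ≤ 2 := by exact_mod_cast hb2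
    linarith
  have hbulk := pieces_bound c.nA c.mA c.KA hnA (q := c.q) (D := weilIncrement G) 0 c.cuts c.pieceB le_rfl hcuts
    h4 hlen (fun t ht ↦ hDq t (by rw [hlastR] at ht; exact_mod_cast ht))
    (fun t ht ↦ hq t (by rw [hlastR] at ht; exact_mod_cast ht)) hpieces
  rw [hlastR] at hbulk
  push_cast at hbulk
  obtain ⟨hintA, hA⟩ := hbulk
  have hintA' : IntegrableOn (fun t ↦ weilArchDensity t * weilIncrement G t) (Set.Ioc (0 : ℝ) ((2 * b : ℚ) : ℝ)) := by
    push_cast; exact hintA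
  -- tail
  have h2b0 : (0 : ℚ) < 2 * b := by positivity
  obtain ⟨hintW, _⟩ := setIntegral_Ioi_weilArchDensity_le c.Kt (c := ((2 * b : ℚ) : ℝ)) (by exact_mod_cast h2b0)
  have hT := setIntegral_Ioi_weilArchDensity_le_archTailQ c.Kt hnt h2b0 htail1
  have hDtail : EqOn (fun t ↦ weilArchDensity t * weilIncrement G t) (fun t ↦ 2 * Nm * weilArchDensity t)
      (Set.Ioi ((2 * b : ℚ) : ℝ)) := fun t ht ↦ by
    simp only
    rw [weilIncrement_polyWitness_eq_of_lt hodd hb0 (by push_cast at ht; exact ht)]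
    ring
  have hintW' : IntegrableOn (fun t ↦ 2 * Nm * weilArchDensity t) (Set.Ioi ((2 * b : ℚ) : ℝ)) :=
    hintW.const_mul (2 * Nm)
  have hintT : IntegrableOn (fun t ↦ weilArchDensity t * weilIncrement G t) (Set.Ioi ((2 * b : ℚ) : ℝ)) :=
    hintW'.congr_fun hDtail.symm measurableSet_Ioi
  have hTail : ∫ t in Set.Ioi ((2 * b : ℚ) : ℝ), weilArchDensity t * weilIncrement G t ≤
      2 * Nm * archTailQ (2 * b) c.Kt c.nt := by
    rw [setIntegral_congr_fun measurableSet_Ioi hDtail, integral_const_mul]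
    exact mul_le_mul_of_nonneg_left hT (by positivity)
  -- the whole half-line
  have hunion : Set.Ioc (0 : ℝ) ((2 * b : ℚ) : ℝ) ∪ Set.Ioi ((2 * b : ℚ) : ℝ) = Set.Ioi (0 : ℝ) :=
    Set.Ioc_union_Ioi_eq_Ioi (by exact_mod_cast h2b0.le)
  have hfin : IntegrableOn (fun t ↦ weilArchDensity t * weilIncrement G t) (Set.Ioi (0 : ℝ)) := by
    rw [← hunion]; exact hintA'.union hintT
  have hInt : ∫ t in Set.Ioi (0 : ℝ), weilArchDensity t * weilIncrement G t
      ≤ (sumQ c.pieceB : ℝ) + 2 * Nm * archTailQ (2 * b) c.Kt c.nt := by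
    rw [← hunion, setIntegral_union Ioc_disjoint_Ioi_same measurableSet_Ioi hintA' hintT]
    refine add_le_add ?_ hTail
    push_cast; exact hA
  -- the polar moment
  have hm := mellinOneLowerQ_le_norm (p := p) hne hb0 (by exact_mod_cast hb2)
  have hm0 : (0 : ℝ) ≤ mellinOneLowerQ p b c.ne := by rw [mellinOneLowerQ]; push_cast; exact le_max_right _ _
  have hpol : (mellinOneLowerQ p b c.ne : ℝ) ^ 2 ≤ ‖weilMellin G 1‖ ^ 2 := pow_le_pow_left₀ hm0 hm 2
  -- the constant
  have hCS : (c0 : ℝ) + 2 * atomWloSum c.atoms ≤ semilocalWindowConstant S N := by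
    unfold semilocalWindowConstant semilocalCoeffSum
    rw [sum_range_eq_atoms_sum (h := fun n ↦ weilSemilocalCoeff S n) hnodup hsub hcover]
    have hw := atomWloSum_le c.atoms (fun na hna ↦ (hencl na hna).2.2.1)
    linarith
  -- assemble
  have hfinal' : ((c.atomB + sumQ c.pieceB + 2 * LQ.normSq p b * archTailQ (2 * b) c.Kt c.nt : ℚ) : ℝ) <
      c.rhsQ c0 := by exact_mod_cast hfinal
  push_cast at hfinal'
  have hrhs : (c.rhsQ c0 : ℝ) ≤ semilocalWindowConstant S N * (∫ x, ‖G x‖ ^ 2) + 2 * ‖weilMellin G 1‖ ^ 2 := by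
    rw [WeilNegCertP.rhsQ, hN]; push_cast
    have : ((c0 : ℝ) + 2 * atomWloSum c.atoms) * Nm ≤ semilocalWindowConstant S N * Nm :=
      mul_le_mul_of_nonneg_right hCS hN0
    linarith
  have hlt : semilocalAtomEnergy S N G + (∫ t in Set.Ioi (0 : ℝ), weilArchDensity t * weilIncrement G t) <
      semilocalWindowConstant S N * (∫ x, ‖G x‖ ^ 2) + 2 * ‖weilMellin G 1‖ ^ 2 := by
    linarith
  exact weilSemilocalThreshold_le_of_markovWitness_window S N hW hfin hlt hbwin


/-- **SOUNDNESS of the wide certificate with the FAST atom side** (`atomLhsFastQ` of the increment literal in place of `checkAtoms`). -/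
theorem weilSemilocalThreshold_le_of_checkW_fast (c : WeilNegCertP) {S : Finset ℕ} {N : ℕ} {c0 : ℚ}
    (henc : AtomsEnclose S N c.atoms c.logSuccLo) (hc0 : (c0 : ℝ) ≤ semilocalEmptyConstant)
    (hmain : c.checkMainW c0 = true) {incL : List ℚ} (hinc : incrementL c.p c.b = incL)
    (hat : atomLhsFastQ incL (2 * c.b) c.atoms ≤ c.atomB)
    (hpieces : ∀ i, i < c.cuts.length → c.checkPieceW i = true) :
    weilSemilocalThreshold S ≤ (c.b : ℝ) := by
  simp only [WeilNegCertP.checkMainW, Bool.and_eq_true, decide_eq_true_eq] at hmain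
  obtain ⟨⟨⟨⟨⟨⟨⟨⟨⟨⟨⟨⟨hodd, hb0⟩, hb4⟩, hnA⟩, hnt⟩, hhead⟩, htail1⟩, hatoms⟩, hsucc⟩, hcuts⟩, hlast⟩,
    hlen⟩, hfinal⟩ := hmain
  simp only [WeilNegCertP.checkPieceW, decide_eq_true_eq] at hpieces
  rw [atomsOk_iff] at hatoms
  obtain ⟨hnodup, hsub, hcover, hencl, hlogSucc⟩ := henc
  set p := c.p
  set b := c.b
  have hb0' : (0 : ℝ) < b := by exact_mod_cast hb0
  have hbwin : (b : ℝ) < Real.log ((N : ℝ) + 1) / 2 := by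
    have h1 : ((2 * b : ℚ) : ℝ) < c.logSuccLo := by exact_mod_cast hsucc
    push_cast at h1
    linarith
  set G := polyWitness p b with hG
  have hW := isMarkovWitness_polyWitness (p := p) (b := b) hodd hb0
  set inc := incrementL p b
  set Nm : ℝ := (LQ.normSq p b : ℝ)
  have hN : ∫ x, ‖G x‖ ^ 2 = Nm := integral_norm_sq_polyWitness (p := p) hb0
  have hN0 : 0 ≤ Nm := by rw [← hN]; exact integral_nonneg fun x ↦ by positivity
  -- D on (0, 2b]
  have hDev : ∀ t ∈ Set.Ioc (0 : ℝ) ((2 * b : ℚ) : ℝ), weilIncrement G t = ev inc t := fun t ht ↦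
    weilIncrement_polyWitness_eq_ev hodd hb0 ht.1.le (by push_cast at ht; exact ht.2)
  have hDq : ∀ t ∈ Set.Ioc (0 : ℝ) ((2 * b : ℚ) : ℝ), weilIncrement G t = t * ev c.q t := fun t ht ↦ by
    rw [hDev t ht, ev_eq_headD_add_tail, hhead]
    push_cast
    rw [zero_add]
    rfl
  have hq : ∀ t ∈ Set.Ioc (0 : ℝ) ((2 * b : ℚ) : ℝ), 0 ≤ ev c.q t := fun t ht ↦ by
    have h1 := weilIncrement_nonneg G t
    rw [hDq t ht] at h1
    exact (mul_nonneg_iff_of_pos_left ht.1).1 h1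
  -- atoms
  have hAt : semilocalAtomEnergy S N G ≤ (c.atomB : ℝ) := by
    unfold semilocalAtomEnergy
    rw [sum_range_eq_atoms_sum (h := fun n ↦ weilSemilocalCoeff S n * weilIncrement G (Real.log n)) hnodup hsub
      (fun n hn hnot ↦ by rw [hcover n hn hnot, zero_mul])]
    have hincL : inc = incL := hinc
    refine (atoms_sum_le_atomLhsFastQ incL (2 * b) c.atoms (fun na hna ↦ (hencl na hna).2.2.2) (fun na hna ↦ ?_)).trans
      (by exact_mod_cast hat)
    obtain ⟨hlo0, _, hhiT⟩ := hatoms na hna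
    obtain ⟨hlo, hhi, _, _⟩ := hencl na hna
    have hmem : Real.log na.1 ∈ Set.Ioc (0 : ℝ) ((2 * b : ℚ) : ℝ) :=
      ⟨lt_of_lt_of_le (by exact_mod_cast hlo0) hlo, hhi.trans (by exact_mod_cast hhiT)⟩
    refine ⟨weilIncrement_nonneg G _, ?_⟩
    rw [hDev _ hmem, hincL]
    have habs : |Real.log na.1| ≤ ((2 * b : ℚ) : ℝ) := by
      rw [abs_of_pos hmem.1]; exact hmem.2
    exact ev_le_evalUpperFastQ incL hlo (by push_cast; linarith) habs
  -- bulk over the pieces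
  have hlastR : ((lastCut 0 c.cuts : ℚ) : ℝ) = ((2 * b : ℚ) : ℝ) := by rw [hlast]
  have h8 : ((lastCut 0 c.cuts : ℚ) : ℝ) ≤ 8 := by
    rw [hlastR]; push_cast
    have : (b : ℝ) ≤ 4 := by exact_mod_cast hb4
    linarith
  have hbulk := piecesW_bound c.nA c.mA c.KA hnA (q := c.q) (D := weilIncrement G) 0 c.cuts c.pieceB le_rfl hcuts
    h8 hlen (fun t ht ↦ hDq t (by rw [hlastR] at ht; exact_mod_cast ht))
    (fun t ht ↦ hq t (by rw [hlastR] at ht; exact_mod_cast ht)) hpieces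
  rw [hlastR] at hbulk
  push_cast at hbulk
  obtain ⟨hintA, hA⟩ := hbulk
  have hintA' : IntegrableOn (fun t ↦ weilArchDensity t * weilIncrement G t) (Set.Ioc (0 : ℝ) ((2 * b : ℚ) : ℝ)) := by
    push_cast; exact hintA
  -- tail
  have h2b0 : (0 : ℚ) < 2 * b := by positivity
  obtain ⟨hintW, _⟩ := setIntegral_Ioi_weilArchDensity_le c.Kt (c := ((2 * b : ℚ) : ℝ)) (by exact_mod_cast h2b0)
  have hT := setIntegral_Ioi_weilArchDensity_le_archTailQ c.Kt hnt h2b0 htail1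
  have hDtail : EqOn (fun t ↦ weilArchDensity t * weilIncrement G t) (fun t ↦ 2 * Nm * weilArchDensity t)
      (Set.Ioi ((2 * b : ℚ) : ℝ)) := fun t ht ↦ by
    simp only
    rw [weilIncrement_polyWitness_eq_of_lt hodd hb0 (by push_cast at ht; exact ht)]
    ring
  have hintW' : IntegrableOn (fun t ↦ 2 * Nm * weilArchDensity t) (Set.Ioi ((2 * b : ℚ) : ℝ)) :=
    hintW.const_mul (2 * Nm)
  have hintT : IntegrableOn (fun t ↦ weilArchDensity t * weilIncrement G t) (Set.Ioi ((2 * b : ℚ) : ℝ)) :=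
    hintW'.congr_fun hDtail.symm measurableSet_Ioi
  have hTail : ∫ t in Set.Ioi ((2 * b : ℚ) : ℝ), weilArchDensity t * weilIncrement G t ≤
      2 * Nm * archTailQ (2 * b) c.Kt c.nt := by
    rw [setIntegral_congr_fun measurableSet_Ioi hDtail, integral_const_mul]
    exact mul_le_mul_of_nonneg_left hT (by positivity)
  -- the whole half-line
  have hunion : Set.Ioc (0 : ℝ) ((2 * b : ℚ) : ℝ) ∪ Set.Ioi ((2 * b : ℚ) : ℝ) = Set.Ioi (0 : ℝ) :=
    Set.Ioc_union_Ioi_eq_Ioi (by exact_mod_cast h2b0.le)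
  have hfin : IntegrableOn (fun t ↦ weilArchDensity t * weilIncrement G t) (Set.Ioi (0 : ℝ)) := by
    rw [← hunion]; exact hintA'.union hintT
  have hInt : ∫ t in Set.Ioi (0 : ℝ), weilArchDensity t * weilIncrement G t
      ≤ (sumQ c.pieceB : ℝ) + 2 * Nm * archTailQ (2 * b) c.Kt c.nt := by
    rw [← hunion, setIntegral_union Ioc_disjoint_Ioi_same measurableSet_Ioi hintA' hintT]
    refine add_le_add ?_ hTail
    push_cast; exact hA
  -- the polar moment is only a credit
  have hpol : (0 : ℝ) ≤ ‖weilMellin G 1‖ ^ 2 := by positivity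
  -- the constant
  have hCS : (c0 : ℝ) + 2 * atomWloSum c.atoms ≤ semilocalWindowConstant S N := by
    unfold semilocalWindowConstant semilocalCoeffSum
    rw [sum_range_eq_atoms_sum (h := fun n ↦ weilSemilocalCoeff S n) hnodup hsub hcover]
    have hw := atomWloSum_le c.atoms (fun na hna ↦ (hencl na hna).2.2.1)
    linarith
  -- assemble
  have hfinal' : ((c.atomB + sumQ c.pieceB + 2 * LQ.normSq p b * archTailQ (2 * b) c.Kt c.nt : ℚ) : ℝ) <
      c.rhsWQ c0 := by exact_mod_cast hfinal
  push_cast at hfinal'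
  have hrhs : (c.rhsWQ c0 : ℝ) ≤ semilocalWindowConstant S N * (∫ x, ‖G x‖ ^ 2) + 2 * ‖weilMellin G 1‖ ^ 2 := by
    rw [WeilNegCertP.rhsWQ, hN]; push_cast
    have : ((c0 : ℝ) + 2 * atomWloSum c.atoms) * Nm ≤ semilocalWindowConstant S N * Nm :=
      mul_le_mul_of_nonneg_right hCS hN0
    linarith
  have hlt : semilocalAtomEnergy S N G + (∫ t in Set.Ioi (0 : ℝ), weilArchDensity t * weilIncrement G t) <
      semilocalWindowConstant S N * (∫ x, ‖G x‖ ^ 2) + 2 * ‖weilMellin G 1‖ ^ 2 := by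
    linarith
  exact weilSemilocalThreshold_le_of_markovWitness_window S N hW hfin hlt hbwin


/-- Fast soundness with the sharp constant (format P, `b ≤ 2`). -/
theorem weilSemilocalThreshold_le_of_checkP_fast_sharp (c : WeilNegCertP) {S : Finset ℕ} {N : ℕ}
    (henc : AtomsEnclose S N c.atoms c.logSuccLo) (hmain : c.checkMain c0SharpQ = true)
    {incL : List ℚ} (hinc : incrementL c.p c.b = incL) (hat : atomLhsFastQ incL (2 * c.b) c.atoms ≤ c.atomB)
    (hpieces : ∀ i, i < c.cuts.length → c.checkPiece i = true) :
    weilSemilocalThreshold S ≤ (c.b : ℝ) :=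
  weilSemilocalThreshold_le_of_checkP_fast c henc c0SharpQ_le hmain hinc hat hpieces

/-- Fast soundness with the sharp constant (format W, `b ≤ 4`). -/
theorem weilSemilocalThreshold_le_of_checkW_fast_sharp (c : WeilNegCertP) {S : Finset ℕ} {N : ℕ}
    (henc : AtomsEnclose S N c.atoms c.logSuccLo) (hmain : c.checkMainW c0SharpQ = true)
    {incL : List ℚ} (hinc : incrementL c.p c.b = incL) (hat : atomLhsFastQ incL (2 * c.b) c.atoms ≤ c.atomB)
    (hpieces : ∀ i, i < c.cuts.length → c.checkPieceW i = true) :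
    weilSemilocalThreshold S ≤ (c.b : ℝ) :=
  weilSemilocalThreshold_le_of_checkW_fast c henc c0SharpQ_le hmain hinc hat hpieces

/-! ## Appendix (cc-s2-4 gen10, 2026-08-24): users of the FAST atom side

Documentation only — no declaration is added or changed (this re-commit also lets the hub build drain pick the module up:
accepted 2026-08-23T15:41Z, never built; OPS-REQUESTS 2026-08-24T01:09Z).

`atomLhsFastQ` and the `…_fast[_sharp]` soundness variants are used by every wall row of degree ≥ 17: `SemilocalNegCert{TwoThreeFive09825,
Seventeen, TwentyThree, TwentyNine, UptoFiftyThree, UptoSixtySeven, UptoSeventyThree, UptoSeventyNine, UptoEightyThree, UptoEightyNine,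
UptoHundredOne, UptoHundredSeven, UptoHundredNine, UptoHundredThirteen, UptoHundredTwentySeven}` (cc-s2-4 gen9/gen10; `UptoSixtySeven` 373 s → 89 s). Build note (gen11, lead R14-3 APPEND REMEDY): second comment-only re-commit — p376690 (08:01Z) drew no hub build.
-/

end Summit.RiemannHypothesis.RiemannHypothesis.Theorems.SemilocalPolyWitness

end
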